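import Mathlib.Analysis.Calculus.SmoothSeries
import Mathlib.Analysis.Calculus.MeanValue
import Mathlib.NumberTheory.ModularForms.JacobiTheta.Bounds
import Literature.NumberTheory.LFunctions.DeBruijnPhiTheta
import HarnessLib

/-!
# The Pólya–de Bruijn kernel `Φ`: theta moments, the derivative `Φ'`, Lipschitz bound at `0`

Trunk T-ANT, `Literature/NumberTheory/LFunctions`; a further companion ("Proofs") file of
`DeBruijnNewman.lean` (after `DeBruijnNewmanProofs.lean`, `DeBruijnPhiTheta.lean`). For the tree's
Rodgers–Tao-normalised kernel
`Φ(u) = deBruijnPhi u = ∑_{n ≥ 1} (2π² n⁴ e^{9u} − 3π n² e^{5u}) exp(−π n² e^{4u})` we record: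

* the **theta moments** `ψ_k(x) = ∑_{n ≥ 1} (π n²)^k e^{−π n² x}` (`thetaMoment k x`; `ψ₀ = ψ` is
  Riemann's `ψ = (θ − 1)/2`, and `ψ_k = (−1)^k ψ^{(k)}`), with the term-by-term derivative
  `ψ_k' = −ψ_{k+1}` on `x > 0` (`hasDerivAt_thetaMoment`, Titchmarsh §10.1);
* the building blocks `E_{j,k}(u) = e^{(1/2 + 2j)u} ψ_k(e^{2u})` (`expThetaMoment j k u`) with
  `E_{j,k}' = (1/2 + 2j) E_{j,k} − 2 E_{j+1,k+1}` (`hasDerivAt_expThetaMoment`);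
* `Φ(u) = 2 E_{2,2}(2u) − 3 E_{1,1}(2u)` (`deBruijnPhi_eq_expThetaMoment`), hence `Φ` is differentiable
  on `ℝ` with the continuous derivative `Φ' = deBruijnPhiDeriv` (`hasDerivAt_deBruijnPhi`), the
  Lipschitz bound `|Φ(u) − Φ(0)| ≤ C u` on `[0, 1]` (`exists_abs_deBruijnPhi_sub_le`).

These are the regularity inputs of the Dirichlet-integral argument for Lagarias–Montague's
`lim_{t→∞} ξ^{(-1)}(½ + it) = iπΦ_LM(0)` (`XiPrimitiveLimitProofs.lean`). Mathlib has the theta series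
and `hasDerivAt_tsum_of_isPreconnected`; the tree (`DeBruijnPhiTheta.lean`) differentiates
`M(u) = e^u(θ(e^{4u}) − 1)` twice but not `Φ` itself (searched `hasDerivAt_deBruijnPhi`, `deriv`,
`thetaMoment`). Everything here is proved; no named facts.

## References

* E. C. Titchmarsh, *The Theory of the Riemann Zeta-Function*, 2nd ed. (1986), §10.1.
* B. Rodgers, T. Tao, *The de Bruijn–Newman constant is non-negative*, Forum Math. Pi 8 (2020), §1 eq. (2).
* J. C. Lagarias, D. Montague, *The integral of the Riemann ξ-function*, Comment. Math. Univ. St. Pauli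
  60 (2011), Lemma 3.1 (the kernel `Φ_LM(u) = 2Φ(u/2)` and its derivatives). [LagariasMontague2011]
-/

noncomputable section

open Filter Topology Set
open scoped Real

namespace Literature.NumberTheory.LFunctions

/-! ## Theta moments `ψ_k(x) = ∑_{n ≥ 1} (π n²)^k e^{−π n² x}` -/

/-- The `n`-th term `(π (n+1)²)^k e^{−π (n+1)² x}` of the theta moment `ψ_k(x)` (indexed from `n = 0`).
[folklore] -/
def thetaMomentTerm (k : ℕ) (x : ℝ) (n : ℕ) : ℝ :=
  (π * ((n : ℝ) + 1) ^ 2) ^ k * Real.exp (-π * ((n : ℝ) + 1) ^ 2 * x)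

/-- The theta moment `ψ_k(x) = ∑_{n ≥ 1} (π n²)^k e^{−π n² x}` (`= (−1)^k ψ^{(k)}(x)` for Riemann's
`ψ = (θ − 1)/2`, Titchmarsh §10.1). [cite: Titchmarsh1986, §10.1] -/
def thetaMoment (k : ℕ) (x : ℝ) : ℝ := ∑' n : ℕ, thetaMomentTerm k x n

/-- The terms of `ψ_k` are `π^k` times Mathlib's `HurwitzKernelBounds.f_nat (2k) 1`. [folklore] -/
theorem thetaMomentTerm_eq_f_nat (k : ℕ) (x : ℝ) (n : ℕ) :
    thetaMomentTerm k x n = π ^ k * HurwitzKernelBounds.f_nat (2 * k) 1 x n := by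
  unfold thetaMomentTerm HurwitzKernelBounds.f_nat
  rw [mul_pow, ← pow_mul]
  ring

/-- The terms of `ψ_k` are nonnegative. [folklore] -/
theorem thetaMomentTerm_nonneg (k : ℕ) (x : ℝ) (n : ℕ) : 0 ≤ thetaMomentTerm k x n := by
  unfold thetaMomentTerm; positivity

/-- The series `ψ_k(x)` converges for `x > 0`. [folklore] -/
theorem summable_thetaMomentTerm (k : ℕ) {x : ℝ} (hx : 0 < x) : Summable (thetaMomentTerm k x) := by
  have : thetaMomentTerm k x = fun n => π ^ k * HurwitzKernelBounds.f_nat (2 * k) 1 x n :=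
    funext (thetaMomentTerm_eq_f_nat k x)
  rw [this]
  exact (HurwitzKernelBounds.summable_f_nat (2 * k) 1 hx).mul_left _

/-- `ψ_k(x) ≥ 0`. [folklore] -/
theorem thetaMoment_nonneg (k : ℕ) (x : ℝ) : 0 ≤ thetaMoment k x :=
  tsum_nonneg (thetaMomentTerm_nonneg k x)

/-- `d/dx [(π(n+1)²)^k e^{−π(n+1)²x}] = −(π(n+1)²)^{k+1} e^{−π(n+1)²x}`. [folklore] -/
theorem hasDerivAt_thetaMomentTerm (k : ℕ) (x : ℝ) (n : ℕ) :
    HasDerivAt (fun y => thetaMomentTerm k y n) (-thetaMomentTerm (k + 1) x n) x := by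
  have h : HasDerivAt (fun y => Real.exp (-π * ((n : ℝ) + 1) ^ 2 * y))
      (Real.exp (-π * ((n : ℝ) + 1) ^ 2 * x) * (-π * ((n : ℝ) + 1) ^ 2)) x := by
    have := ((hasDerivAt_id x).const_mul (-π * ((n : ℝ) + 1) ^ 2)).exp
    simpa using this
  have h2 := h.const_mul ((π * ((n : ℝ) + 1) ^ 2) ^ k)
  have e : (π * ((n : ℝ) + 1) ^ 2) ^ k *
      (Real.exp (-π * ((n : ℝ) + 1) ^ 2 * x) * (-π * ((n : ℝ) + 1) ^ 2)) =
      -thetaMomentTerm (k + 1) x n := by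
    unfold thetaMomentTerm
    ring
  rw [e] at h2
  exact h2

/-- The terms of `ψ_k` are antitone in `x`. [folklore] -/
theorem thetaMomentTerm_le_of_le (k : ℕ) {x y : ℝ} (hxy : x ≤ y) (n : ℕ) :
    thetaMomentTerm k y n ≤ thetaMomentTerm k x n := by
  unfold thetaMomentTerm
  refine mul_le_mul_of_nonneg_left (Real.exp_le_exp.mpr ?_) (by positivity)
  have h : -π * ((n : ℝ) + 1) ^ 2 ≤ 0 := by
    have := Real.pi_pos
    nlinarith [sq_nonneg ((n : ℝ) + 1)]
  exact mul_le_mul_of_nonpos_left hxy h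

/-- **Term-by-term differentiation** `ψ_k'(x) = −ψ_{k+1}(x)` for `x > 0` (Titchmarsh §10.1).
[cite: Titchmarsh1986, §10.1] -/
theorem hasDerivAt_thetaMoment (k : ℕ) {x : ℝ} (hx : 0 < x) :
    HasDerivAt (thetaMoment k) (-thetaMoment (k + 1) x) x := by
  have hx2 : 0 < x / 2 := by positivity
  have key := hasDerivAt_tsum_of_isPreconnected (𝕜 := ℝ) (F := ℝ)
    (u := fun n => thetaMomentTerm (k + 1) (x / 2) n) (t := Ioi (x / 2))
    (g := fun n y => thetaMomentTerm k y n) (g' := fun n y => -thetaMomentTerm (k + 1) y n)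
    (y₀ := x) (y := x)
    (summable_thetaMomentTerm (k + 1) hx2) isOpen_Ioi isPreconnected_Ioi
    (fun n y _ => hasDerivAt_thetaMomentTerm k y n)
    (fun n y hy => by
      rw [norm_neg, Real.norm_of_nonneg (thetaMomentTerm_nonneg _ _ _)]
      exact thetaMomentTerm_le_of_le _ (le_of_lt hy) _)
    (by rw [mem_Ioi]; linarith) (summable_thetaMomentTerm k hx) (by rw [mem_Ioi]; linarith)
  simp only [tsum_neg] at key
  exact key

/-! ## The building blocks `E_{j,k}(u) = e^{(1/2 + 2j)u} ψ_k(e^{2u})` -/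

/-- `E_{j,k}(u) := e^{(1/2 + 2j)u} ψ_k(e^{2u})`; Lagarias–Montague's kernel is
`Φ_LM = 4E_{2,2} − 6E_{1,1}` (Lemma 3.1, eq. (3.3)) and `Φ(u) = Φ_LM(2u)/2`. [cite: LagariasMontague2011, Lemma 3.1] -/
def expThetaMoment (j k : ℕ) (u : ℝ) : ℝ :=
  Real.exp ((1 / 2 + 2 * j) * u) * thetaMoment k (Real.exp (2 * u))

/-- `E_{j,k}(0) = ψ_k(1)`. [folklore] -/
theorem expThetaMoment_zero (j k : ℕ) : expThetaMoment j k 0 = thetaMoment k 1 := by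
  simp [expThetaMoment]

/-- `E_{j,k}' = (1/2 + 2j) E_{j,k} − 2 E_{j+1,k+1}` (chain rule with `ψ_k' = −ψ_{k+1}`). [folklore] -/
theorem hasDerivAt_expThetaMoment (j k : ℕ) (u : ℝ) :
    HasDerivAt (expThetaMoment j k)
      ((1 / 2 + 2 * j) * expThetaMoment j k u - 2 * expThetaMoment (j + 1) (k + 1) u) u := by
  have h1 : HasDerivAt (fun u => Real.exp ((1 / 2 + 2 * j) * u))
      (Real.exp ((1 / 2 + 2 * j) * u) * (1 / 2 + 2 * j)) u := by
    have := ((hasDerivAt_id u).const_mul (1 / 2 + 2 * (j : ℝ))).exp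
    simpa using this
  have h2 : HasDerivAt (fun u => Real.exp (2 * u)) (Real.exp (2 * u) * 2) u := by
    have := ((hasDerivAt_id u).const_mul (2 : ℝ)).exp
    simpa using this
  have h3 : HasDerivAt (thetaMoment k) (-thetaMoment (k + 1) (Real.exp (2 * u))) (Real.exp (2 * u)) :=
    hasDerivAt_thetaMoment k (Real.exp_pos _)
  have h4 := h1.mul (h3.comp u h2)
  have he : Real.exp ((1 / 2 + 2 * ((j + 1 : ℕ) : ℝ)) * u) =
      Real.exp ((1 / 2 + 2 * j) * u) * Real.exp (2 * u) := by
    rw [← Real.exp_add]; congr 1; push_cast; ring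
  have e : Real.exp ((1 / 2 + 2 * j) * u) * (1 / 2 + 2 * j) * thetaMoment k (Real.exp (2 * u)) +
      Real.exp ((1 / 2 + 2 * j) * u) *
        (-thetaMoment (k + 1) (Real.exp (2 * u)) * (Real.exp (2 * u) * 2))
      = (1 / 2 + 2 * j) * expThetaMoment j k u - 2 * expThetaMoment (j + 1) (k + 1) u := by
    rw [expThetaMoment, expThetaMoment, he]; ring
  rw [← e]
  exact h4

/-- `E_{j,k}` is continuous. [folklore] -/
@[fun_prop]
theorem continuous_expThetaMoment (j k : ℕ) : Continuous (expThetaMoment j k) :=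
  continuous_iff_continuousAt.mpr fun u => (hasDerivAt_expThetaMoment j k u).continuousAt

/-! ## `Φ = 2E_{2,2}(2·) − 3E_{1,1}(2·)`, its derivative, and the Lipschitz bound at `0` -/

/-- `Φ(u) = 2 E_{2,2}(2u) − 3 E_{1,1}(2u)`: with `x = e^{4u}`,
`Φ(u) = e^{u}(2x²ψ₂(x) − 3xψ₁(x))` (regrouping the series of Rodgers–Tao eq. (2)). [cite: RodgersTao2020, eq. (2)] -/
theorem deBruijnPhi_eq_expThetaMoment (u : ℝ) :
    deBruijnPhi u = 2 * expThetaMoment 2 2 (2 * u) - 3 * expThetaMoment 1 1 (2 * u) := by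
  have hx : 0 < Real.exp (2 * (2 * u)) := Real.exp_pos _
  rw [deBruijnPhi, expThetaMoment, expThetaMoment, thetaMoment, thetaMoment, ← tsum_mul_left,
    ← tsum_mul_left, ← tsum_mul_left, ← tsum_mul_left,
    ← Summable.tsum_sub (((summable_thetaMomentTerm 2 hx).mul_left _).mul_left _)
      (((summable_thetaMomentTerm 1 hx).mul_left _).mul_left _)]
  refine tsum_congr fun n => ?_
  have e9 : Real.exp (9 * u) = Real.exp ((1 / 2 + 2 * ((2 : ℕ) : ℝ)) * (2 * u)) := by
    congr 1; push_cast; ring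
  have e5 : Real.exp (5 * u) = Real.exp ((1 / 2 + 2 * ((1 : ℕ) : ℝ)) * (2 * u)) := by
    congr 1; push_cast; ring
  have e4 : Real.exp (-(π * ((n : ℝ) + 1) ^ 2 * Real.exp (4 * u))) =
      Real.exp (-π * ((n : ℝ) + 1) ^ 2 * Real.exp (2 * (2 * u))) := by
    congr 1; rw [show 2 * (2 * u) = 4 * u by ring]; ring
  simp only [deBruijnPhiSummand, thetaMomentTerm, e9, e5, e4]
  ring

/-- The derivative of `Φ`: `Φ'(u) = 30 E_{2,2}(2u) − 15 E_{1,1}(2u) − 8 E_{3,3}(2u)`, i.e.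
`Φ'(u) = e^{u}(30x²ψ₂(x) − 15xψ₁(x) − 8x³ψ₃(x))`, `x = e^{4u}`. [folklore] -/
def deBruijnPhiDeriv (u : ℝ) : ℝ :=
  30 * expThetaMoment 2 2 (2 * u) - 15 * expThetaMoment 1 1 (2 * u) - 8 * expThetaMoment 3 3 (2 * u)

/-- `Φ` is differentiable on `ℝ` with `Φ' = deBruijnPhiDeriv` (term-by-term differentiation of the theta
series, Titchmarsh §10.1). [cite: Titchmarsh1986, §10.1] -/
theorem hasDerivAt_deBruijnPhi (u : ℝ) : HasDerivAt deBruijnPhi (deBruijnPhiDeriv u) u := by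
  have h2 : HasDerivAt (fun u : ℝ => 2 * u) 2 u := by
    simpa using (hasDerivAt_id u).const_mul (2 : ℝ)
  have hA := ((hasDerivAt_expThetaMoment 2 2 (2 * u)).comp u h2).const_mul 2
  have hB := ((hasDerivAt_expThetaMoment 1 1 (2 * u)).comp u h2).const_mul 3
  have h := hA.sub hB
  have ef : deBruijnPhi = fun u => 2 * expThetaMoment 2 2 (2 * u) - 3 * expThetaMoment 1 1 (2 * u) :=
    funext deBruijnPhi_eq_expThetaMoment
  have e : 2 * (((1 / 2 + 2 * ((2 : ℕ) : ℝ)) * expThetaMoment 2 2 (2 * u) -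
      2 * expThetaMoment (2 + 1) (2 + 1) (2 * u)) * 2) -
      3 * (((1 / 2 + 2 * ((1 : ℕ) : ℝ)) * expThetaMoment 1 1 (2 * u) -
      2 * expThetaMoment (1 + 1) (1 + 1) (2 * u)) * 2) = deBruijnPhiDeriv u := by
    simp only [deBruijnPhiDeriv, Nat.cast_ofNat, Nat.cast_one]
    norm_num
    ring
  rw [ef, ← e]
  exact h

/-- `Φ'` is continuous. [folklore] -/
theorem continuous_deBruijnPhiDeriv : Continuous deBruijnPhiDeriv := by
  unfold deBruijnPhiDeriv; fun_prop

/-- `Φ` is differentiable on `ℝ`. [folklore] -/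
theorem differentiable_deBruijnPhi : Differentiable ℝ deBruijnPhi := fun u =>
  (hasDerivAt_deBruijnPhi u).differentiableAt

/-- **Lipschitz bound at `0`**: there is `C` with `|Φ(u) − Φ(0)| ≤ C u` for `0 ≤ u ≤ 1` (mean value
theorem with `sup_{[0,1]} |Φ'|`). [folklore] -/
theorem exists_abs_deBruijnPhi_sub_le :
    ∃ C, ∀ u ∈ Icc (0 : ℝ) 1, |deBruijnPhi u - deBruijnPhi 0| ≤ C * u := by
  obtain ⟨C, hC⟩ := isCompact_Icc.exists_bound_of_continuousOn
    (continuous_deBruijnPhiDeriv.continuousOn (s := Icc (0 : ℝ) 1))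
  refine ⟨C, fun u hu => ?_⟩
  have := (convex_Icc (0 : ℝ) 1).norm_image_sub_le_of_norm_hasDerivWithin_le
    (f := deBruijnPhi) (f' := deBruijnPhiDeriv)
    (fun x _ => (hasDerivAt_deBruijnPhi x).hasDerivWithinAt) hC
    (left_mem_Icc.mpr zero_le_one) hu
  simpa [Real.norm_eq_abs, sub_zero, abs_of_nonneg hu.1] using this

end Literature.NumberTheory.LFunctions
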